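import Literature.Barriers.PneNP.HadamardNotRigid
import Mathlib.Analysis.SpecialFunctions.Trigonometric.Series
import HarnessLib

/-!
# The Walsh–Hadamard transform is not Valiant-rigid — the proof
(Alman–Williams 2017, Thm. 1.1; Alman 2021, Thm. 5.2)

Companion to `Literature/Barriers/PneNP/HadamardNotRigid.lean` (the D-0021 barrier entry: the
named fact `HadamardNotRigid`, stated there with the exponent its sources establish,
`c·ε²/log²(1/ε)`). This file

* PROVES the entry's fact for every field, with the explicit constants `c = 1/400`, `ε₀ = 1/30`:
  the quantitative form `rigidity_walshHadamard_le_rpow` and the discharge `HadamardNotRigid_holds`;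
* proves the barrier's route-facing readings UNCONDITIONALLY: for every field `K` and every
  `δ > 0`, eventually `𝓡_{H_n}(⌊2ⁿ/n⌋) < 2^{(1+δ)n}` (`walshHadamard_no_valiant_rigidity`) and
  `𝓡_{H_n}(⌊2ⁿ/log₂ n⌋) < 2^{(1+δ)n}` (`walshHadamard_no_valiant_rigidity_log`) — Valiant's
  rigidity road to super-linear lower bounds for log-depth linear circuits is closed for `H_n`;
* keeps, DEPRECATED (attributes attached at the end of the file), the second name
  `HadamardNotRigidLogSq` of the same proposition together with `HadamardNotRigidLogSq_holds`,
  `HadamardNotRigidLogSq.no_valiant_rigidity` and `HadamardNotRigid.logSq` — see the history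
  paragraph.

**History: the exponent (what is printed vs. what is proved), and the two names.**
[AlmanWilliams2017] Thm. 1.1 (§1; restated at the head of §3): "For every field `K`, for every
sufficiently small `ε > 0`, and for all `n`, we have `𝓡_{H_n}(2^{n−f(ε)n}) ≤ 2^{n(1+ε)}` over `K`,
for a function `f` where `f(ε) = Θ(ε²/log(1/ε))`." The printed proof (§3) works with a parameter
`a` (called `ε` there): a polynomial correct on `⟨x,y⟩ ∈ [2an, (1/2+a)n]` with `2^{n−Ω(a²n)}`
monomials (Lemma 3.1), unbalanced rows/columns corrected at rank cost `4n·2^{n−Ω(a²n)}`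
(Cor. 3.1), and per-row residual errors `≤ n²·2^{f(a,a)n}`,
`f(a,b) = (1/2+a)(4b log(1/2b) + (8a+4b) log(1/(4a+2b)))` (Lemma 3.3); its last sentence reads
"`M'` has rank at most `m + 4·n·2^{n−Ω(ε²n)} ≤ 5n·2^{n−Ω(ε²n)}`. Furthermore, on every row, `M'`
differs from `H_n` in at most `n²·2^{f(ε,ε)} ≤ 2^{O(ε log(1/ε)n)}` entries." So at sparsity
exponent `ε' = Θ(a log(1/a))` the rank deficit is `Θ(a²) = Θ(ε'²/log²(1/ε'))` — one logarithm
more in the denominator than the theorem states. The later literature states the bound with the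
square: [Alman2021Kronecker] §1.1: "using the rigidity upper bound
`𝓡_{H_n}(N^{1−Θ(ε²/log²(1/ε))}) ≤ N^{1+ε}` for any `ε > 0` of [AW17]"; ibid. §1.3 and
§5, Thm. 5.2: "`𝓡^{rc}_{R_n}(2^{(1−Θ(ε²/log²(1/ε)))·n}) ≤ 2^{ε·n}`";
[Kivva2021] §1.1, Thm. 1.2 (Alman's theorem for Kronecker products of `d × d` matrices):
`γ = Ω_d(ε²/log²(1/ε))`. None of these sources establishes the single logarithm. When this was
found (2026-08-15) the entry `HadamardNotRigid` rendered the printed single-logarithm sentence; a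
prove-seat may not restate an entry, so the corrected statement was vendored and proved HERE
under the new name `HadamardNotRigidLogSq`, and the entry was parked with the verdict MIS-STATED.
The named-fact verdict clean-up (2026-08-16; human ruling 2026-08-15: restate, do not delete,
keeping the old name when the correction is meaning-preserving for its users) then restated the
ENTRY in place — `HadamardNotRigid` now carries `Real.log (1 / ε) ^ 2`, i.e. it IS the
proposition proved here — and this file accordingly (i) discharges it by name
(`HadamardNotRigid_holds`), (ii) turns `HadamardNotRigidLogSq` into the by-name synonym
`:= HadamardNotRigid` (no second copy of the statement), deprecated, together with its discharge
`HadamardNotRigidLogSq_holds` (kept: the ledger recorded the prove-seat's item as closed by it) and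
its reading `HadamardNotRigidLogSq.no_valiant_rigidity`, and (iii) keeps `HadamardNotRigid.logSq`
(`HadamardNotRigid → HadamardNotRigidLogSq`, now an identity) deprecated as well. The deprecation
attributes are attached LAST, so that nothing in this file trips the deprecation linter; any use
elsewhere warns and names the replacement.

**The proof formalised here** is Alman's disjointness decomposition ([Alman2021Kronecker]
§1.3: "`R_n` … has only `3ⁿ` nonzero entries … by removing only the
`2^{n(1−Θ(ε²/log²(1/ε)))}` densest rows and columns of `R_n`, we are left with a matrix with only
`2^{n·ε}` nonzero entries per row or column. Since changing a single row or column of a matrix is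
a rank-1 update, this shows that `R_n` is not Valiant-rigid"; §5, Lemma 5.1 and Thm. 5.2),
run directly on `H_n` through the binomial identity
`H_n(x,y) = (−1)^{|x∩y|} = ∑_{z ⊆ x∩y} (−2)^{|z|}` (i.e. `H_n = Q_nᵀ·diag((−2)^{|z|})·Q_n` with
`Q_n(z,y) = [z ⊆ y]` the inclusion matrix — Alman's disjointness matrix `R_n[x,y] = [x ∩ y = ∅]`
with the column index complemented), indices being subsets of `Fin n`:
* `hadamardLow`/`hadamardHigh`: the terms with `|z| < t` form a matrix of rank `≤ #{z : |z| < t}`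
  (`rank_hadamardLow_le`, a product through the small sets); the terms with `|z| ≥ t` vanish
  unless `|x ∩ y| ≥ t` (`le_card_inter_of_hadamardHigh_ne_zero`);
* heavy rows and columns (`|x| > u`) are kept on the low-rank side at rank cost one each
  (`rank_le_card_of_support_rows/cols`); the changed entries are the high terms at light rows
  and columns, at most `2ⁿ·#{w : |w| ≤ u−t}²` of them via the injection
  `(x,y) ↦ (x, x∖y, y∖x)` (`exists_sparse_correction_hadamardSet`);
* transport to the tree's `walshHadamard K n` (indexed by `Fin 2ⁿ` through `testBit`) along the
  bijection `bitsEquiv` (`walshHadamard_eq_submatrix`, `rigidity_walshHadamard_le_comb`):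
  `𝓡_{H_n}(#{|z| < t} + 2·#{|x| > u}) ≤ 2ⁿ·#{|w| ≤ u−t}²` for all `t, u`, every field;
* binomial tails as subset counts: Hoeffding `#{|z| ≤ (1/2−δ)n}, #{|x| ≥ (1/2+δ)n} ≤ 2ⁿe^{−2δ²n}`
  (Chernoff with `cosh t ≤ e^{t²/2}`) and `#{|w| ≤ L} ≤ e^L (n/L)^L`;
* with `t = ⌈(1/2−δ)n⌉`, `u = ⌊(1/2+δ)n⌋`, `δ = ε/(20 log(1/ε))`: rank
  `≤ 3·2ⁿe^{−2δ²n} ≤ 2^{(1−δ²)n}` once `δ²n ≥ 2`, and changes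
  `≤ 2ⁿ e^{4δn}(1/2δ)^{4δn} ≤ 2^{(1+ε)n}` as `4δ(1 + log(1/2δ)) ≤ (3/5)ε ≤ ε log 2` for
  `ε ≤ 1/30` (`rigidity_walshHadamard_le_rpow`).

Deliberately NOT here: the polynomial-method proof of [AlmanWilliams2017] §3 (Lemmas 3.1–3.4);
the per-row ("row-column rigidity") form of the bound; Thm. 1.2 (high-error regime); linear
circuits and Valiant's criterion (quoted in the barrier entry, no linear-circuit model in the
tree).

## Sources

Locators are section / theorem numbers of the arXiv versions, held as text
(`lit read arxiv:<id>`; the held texts are TeX-source renderings, so no PDF page numbers are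
given here).

* [AlmanWilliams2017] arXiv:1611.05558: §1 (Def. 1.1, Thm. 1.1, Thm. 1.2 and the discussion
  after Thm. 1.1), §3 (eqs. (1)–(2), Lemmas 3.1–3.4, Cor. 3.1, proof of Thm. 1.1) — held, read.
* [Alman2021Kronecker] arXiv:2102.11992: §1.1, §1.3 (Thm. 1.8 and the proof sketch for `q = 2`),
  §2.1.4 (`H_n`, `R_n`), §5 (Lemma 5.1, Thm. 5.2), §6 — held, read.
* [Kivva2021] arXiv:2103.05631: abstract, §1.1 (Thm. 1.2), §1.2 (Thms. 1.3–1.4), §1.4 (Thm. 1.7,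
  Remark 1.8) — held, read.
* [DvirLiu2019] arXiv:1902.07334, abstract — held (through `HadamardNotRigid.lean`).
* [Lokam2009] Def. 2.1, Thm. 2.1, Open Question 2.1 (PDF pp. 14–17) — held (through
  `RigidityCombinatorialBarrier.lean`).
-/

noncomputable section

namespace Literature.Barriers.PneNP

open Finset Filter

universe u

section Combinatorial

variable {K : Type*} [Field K]

/-! ### The set-indexed Walsh–Hadamard matrix and its disjointness decomposition -/

/-- The Walsh–Hadamard matrix indexed by subsets of `Fin n`: `H(x, y) = (-1)^{|x ∩ y|}`.
[cite: AlmanWilliams2017, §1, Def. 1.1] -/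
def hadamardSet (K : Type*) [Field K] (n : ℕ) : Matrix (Finset (Fin n)) (Finset (Fin n)) K :=
  fun x y => (-1 : K) ^ (x ∩ y).card

/-- The binomial theorem behind the factorisation `H_n = Q_nᵀ · diag((-2)^{|z|}) · Q_n` through
the inclusion matrix `Q_n(z,y) = [z ⊆ y]` (Alman's disjointness matrix up to complementing an
index): `(-1)^{|s|} = ∑_{z ⊆ s} (-2)^{|z|}`. [folklore] -/
theorem neg_one_pow_card_eq_sum_powerset {n : ℕ} (s : Finset (Fin n)) :
    (-1 : K) ^ s.card = ∑ z ∈ s.powerset, (-2 : K) ^ z.card := by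
  have h := Finset.sum_pow_mul_eq_add_pow (-2 : K) 1 s
  simp only [one_pow, mul_one] at h
  rw [h]
  norm_num

/-- The part of `H_n` carried by the small sets: `A_t(x, y) = ∑_{z ⊆ x ∩ y, |z| < t} (-2)^{|z|}`.
[cite: Alman2021Kronecker, §5] -/
def hadamardLow (K : Type*) [Field K] (n t : ℕ) : Matrix (Finset (Fin n)) (Finset (Fin n)) K :=
  fun x y => ∑ z ∈ (x ∩ y).powerset with z.card < t, (-2 : K) ^ z.card

/-- The part of `H_n` carried by the large sets: `S_t(x, y) = ∑_{z ⊆ x ∩ y, t ≤ |z|} (-2)^{|z|}`.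
[cite: Alman2021Kronecker, §5] -/
def hadamardHigh (K : Type*) [Field K] (n t : ℕ) : Matrix (Finset (Fin n)) (Finset (Fin n)) K :=
  fun x y => ∑ z ∈ (x ∩ y).powerset with t ≤ z.card, (-2 : K) ^ z.card

/-- `H_n = A_t + S_t`: split the binomial sum `H(x,y) = ∑_{z ⊆ x ∩ y} (-2)^{|z|}` at `|z| = t`.
[cite: Alman2021Kronecker, §1.3] -/
theorem hadamardSet_eq_low_add_high (n t : ℕ) :
    hadamardSet K n = hadamardLow K n t + hadamardHigh K n t := by
  ext x y
  simp only [hadamardSet, hadamardLow, hadamardHigh, Matrix.add_apply]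
  rw [neg_one_pow_card_eq_sum_powerset,
    ← Finset.sum_filter_add_sum_filter_not _ (fun z : Finset (Fin n) => z.card < t)]
  congr 1
  refine Finset.sum_congr ?_ (fun _ _ => rfl)
  ext z
  simp [not_lt]

/-- `A_t` factors through the sets of size `< t`, so its rank is at most their number.
[cite: Alman2021Kronecker, §5, Thm. 5.2] -/
theorem rank_hadamardLow_le (n t : ℕ) :
    (hadamardLow K n t).rank ≤
      ((univ : Finset (Finset (Fin n))).filter (fun z => z.card < t)).card := by
  set Z := (univ : Finset (Finset (Fin n))).filter (fun z => z.card < t) with hZ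
  let P : Matrix (Finset (Fin n)) Z K := fun x z => if (z : Finset (Fin n)) ⊆ x then 1 else 0
  let Q : Matrix Z (Finset (Fin n)) K :=
    fun z y => if (z : Finset (Fin n)) ⊆ y then (-2 : K) ^ (z : Finset (Fin n)).card else 0
  have hPQ : hadamardLow K n t = P * Q := by
    ext x y
    have h1 : (P * Q) x y = ∑ z ∈ Z, if (z ⊆ x ∧ z ⊆ y) then (-2 : K) ^ z.card else 0 := by
      simp only [Matrix.mul_apply, P, Q]
      rw [← Finset.sum_coe_sort Z (fun z => if (z ⊆ x ∧ z ⊆ y) then (-2 : K) ^ z.card else 0)]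
      refine Finset.sum_congr rfl fun z _ => ?_
      by_cases hzx : (z : Finset (Fin n)) ⊆ x <;> by_cases hzy : (z : Finset (Fin n)) ⊆ y <;>
        simp [hzx, hzy]
    change (∑ z ∈ (x ∩ y).powerset with z.card < t, (-2 : K) ^ z.card) = (P * Q) x y
    rw [h1, ← Finset.sum_filter]
    refine Finset.sum_congr ?_ fun _ _ => rfl
    ext z
    simp only [Finset.mem_filter, Finset.mem_powerset, Finset.subset_inter_iff, Finset.mem_univ,
      true_and, hZ]
    tauto
  rw [hPQ]
  refine (Matrix.rank_mul_le_left _ _).trans ((Matrix.rank_le_card_width _).trans ?_)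
  simp

/-- A matrix whose nonzero entries all lie in the rows indexed by `R` has rank `≤ |R|`.
[folklore] -/
theorem rank_le_card_of_support_rows {X Y : Type*} [Fintype X] [Fintype Y] [DecidableEq X]
    (M : Matrix X Y K) (R : Finset X) (h : ∀ x, x ∉ R → ∀ y, M x y = 0) : M.rank ≤ R.card := by
  let P : Matrix X ↥R K := fun x r => if x = (r : X) then 1 else 0
  let N : Matrix ↥R Y K := fun r y => M (r : X) y
  have hPN : M = P * N := by
    ext x y
    simp only [Matrix.mul_apply, P, N]
    by_cases hx : x ∈ R
    · rw [Fintype.sum_eq_single (⟨x, hx⟩ : R)]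
      · simp
      · rintro ⟨r, hr⟩ hne
        have : x ≠ r := fun hxr => hne (Subtype.ext hxr.symm)
        simp [this]
    · rw [h x hx y]
      refine (Finset.sum_eq_zero ?_).symm
      rintro ⟨r, hr⟩ _
      have : x ≠ r := fun hxr => hx (hxr ▸ hr)
      simp [this]
  rw [hPN]
  refine (Matrix.rank_mul_le_left _ _).trans ((Matrix.rank_le_card_width _).trans ?_)
  simp

/-- A matrix whose nonzero entries all lie in the columns indexed by `R` has rank `≤ |R|`.
[folklore] -/
theorem rank_le_card_of_support_cols {X Y : Type*} [Fintype X] [Fintype Y] [DecidableEq Y]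
    (M : Matrix X Y K) (R : Finset Y) (h : ∀ y, y ∉ R → ∀ x, M x y = 0) : M.rank ≤ R.card := by
  rw [← Matrix.rank_transpose]
  exact rank_le_card_of_support_rows M.transpose R (fun y hy x => h y hy x)

/-- Subadditivity of matrix rank. [folklore] -/
theorem matrixRank_add_le {X Y : Type*} [Fintype Y] (A B : Matrix X Y K) :
    (A + B).rank ≤ A.rank + B.rank := by
  unfold Matrix.rank
  rw [Matrix.mulVecLin_add]
  calc Module.finrank K (LinearMap.range (A.mulVecLin + B.mulVecLin))
      ≤ Module.finrank K ↥(LinearMap.range A.mulVecLin ⊔ LinearMap.range B.mulVecLin) := by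
        apply Submodule.finrank_mono
        rintro _ ⟨v, rfl⟩
        exact Submodule.add_mem_sup ⟨v, rfl⟩ ⟨v, rfl⟩
    _ ≤ _ := Submodule.finrank_add_le_finrank_add_finrank _ _

/-- If `S_t(x, y) ≠ 0` then `|x ∩ y| ≥ t` (some `z ⊆ x ∩ y` has `|z| ≥ t`).
[cite: Alman2021Kronecker, §5, Lemma 5.1] -/
theorem le_card_inter_of_hadamardHigh_ne_zero {n t : ℕ} {x y : Finset (Fin n)}
    (h : hadamardHigh K n t x y ≠ 0) : t ≤ (x ∩ y).card := by
  by_contra hlt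
  rw [not_le] at hlt
  apply h
  change (∑ z ∈ (x ∩ y).powerset with t ≤ z.card, (-2 : K) ^ z.card) = 0
  rw [Finset.filter_eq_empty_iff.mpr, Finset.sum_empty]
  intro z hz
  rw [Finset.mem_powerset] at hz
  exact not_le.2 ((Finset.card_le_card hz).trans_lt hlt)

open Classical in
/-- **The disjointness decomposition (Alman 2021), combinatorial form.** For all thresholds
`t, u`: changing at most `2ⁿ · #{w : |w| ≤ u - t}²` entries of the set-indexed `H_n` (namely the
entries `S_t(x, y)` at light rows and columns `|x|, |y| ≤ u`) leaves a matrix of rank at most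
`#{z : |z| < t} + 2 · #{x : |x| > u}`. [cite: Alman2021Kronecker, §1.3 and §5, Lemma 5.1, Thm. 5.2] -/
theorem exists_sparse_correction_hadamardSet (n t u : ℕ) :
    ∃ C : Matrix (Finset (Fin n)) (Finset (Fin n)) K,
      (hadamardSet K n + C).rank ≤
          ((univ : Finset (Finset (Fin n))).filter (fun z => z.card < t)).card +
            2 * ((univ : Finset (Finset (Fin n))).filter (fun x => u < x.card)).card ∧
      ((univ : Finset (Finset (Fin n) × Finset (Fin n))).filter (fun p => C p.1 p.2 ≠ 0)).card ≤
          2 ^ n * ((univ : Finset (Finset (Fin n))).filter (fun w => w.card ≤ u - t)).card ^ 2 := by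
  set S := hadamardHigh K n t with hS
  set Hv := (univ : Finset (Finset (Fin n))).filter (fun x => u < x.card) with hHv
  set W := (univ : Finset (Finset (Fin n))).filter (fun w => w.card ≤ u - t) with hW
  let C : Matrix (Finset (Fin n)) (Finset (Fin n)) K :=
    fun x y => if x.card ≤ u ∧ y.card ≤ u then -S x y else 0
  let Srow : Matrix (Finset (Fin n)) (Finset (Fin n)) K :=
    fun x y => if u < x.card then S x y else 0
  let Scol : Matrix (Finset (Fin n)) (Finset (Fin n)) K :=
    fun x y => if x.card ≤ u ∧ u < y.card then S x y else 0
  have hdec : hadamardSet K n + C = hadamardLow K n t + Srow + Scol := by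
    rw [hadamardSet_eq_low_add_high n t]
    ext x y
    simp only [Matrix.add_apply, C, Srow, Scol, ← hS]
    by_cases hx : x.card ≤ u <;> by_cases hy : y.card ≤ u <;> simp [hx, hy, not_lt.2, not_le.1]
  refine ⟨C, ?_, ?_⟩
  · rw [hdec]
    refine (matrixRank_add_le _ _).trans ?_
    refine (add_le_add ((matrixRank_add_le _ _).trans
      (add_le_add (rank_hadamardLow_le n t) ?_)) ?_).trans (by rw [two_mul, add_assoc])
    · refine rank_le_card_of_support_rows Srow Hv fun x hx y => ?_
      have : ¬ u < x.card := by simpa [hHv] using hx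
      simp [Srow, this]
    · refine rank_le_card_of_support_cols Scol Hv fun y hy x => ?_
      have : ¬ u < y.card := by simpa [hHv] using hy
      simp [Scol, this]
  · -- the support of `C` injects into `univ × W × W` via `(x, y) ↦ (x, x \ y, y \ x)`
    have hsupp : ∀ p ∈ (univ : Finset (Finset (Fin n) × Finset (Fin n))).filter
        (fun p => C p.1 p.2 ≠ 0), p.1.card ≤ u ∧ p.2.card ≤ u ∧ t ≤ (p.1 ∩ p.2).card := by
      rintro ⟨x, y⟩ hp
      simp only [Finset.mem_filter, Finset.mem_univ, true_and, C] at hp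
      by_cases hxy : x.card ≤ u ∧ y.card ≤ u
      · simp only [hxy, and_self, ite_true, ne_eq, neg_eq_zero] at hp
        exact ⟨hxy.1, hxy.2, le_card_inter_of_hadamardHigh_ne_zero hp⟩
      · simp [hxy] at hp
    calc ((univ : Finset (Finset (Fin n) × Finset (Fin n))).filter (fun p => C p.1 p.2 ≠ 0)).card
        ≤ ((univ : Finset (Finset (Fin n))) ×ˢ (W ×ˢ W)).card := by
          refine Finset.card_le_card_of_injOn (fun p => (p.1, p.1 \ p.2, p.2 \ p.1)) ?_ ?_
          · intro p hp
            obtain ⟨h1, h2, h3⟩ := hsupp p hp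
            simp only [Finset.coe_product, Set.mem_prod, Finset.mem_coe, Finset.mem_univ,
              true_and, hW, Finset.mem_filter]
            have e1 := Finset.card_sdiff_add_card_inter p.1 p.2
            have e2 := Finset.card_sdiff_add_card_inter p.2 p.1
            rw [Finset.inter_comm] at e2
            constructor <;> omega
          · rintro ⟨x, y⟩ hp ⟨x', y'⟩ hp' heq
            simp only [Prod.mk.injEq] at heq
            obtain ⟨rfl, hxy, hyx⟩ := heq
            have key : ∀ y₀ : Finset (Fin n), y₀ = (y₀ \ x) ∪ (x \ (x \ y₀)) := fun y₀ => by
              rw [sdiff_sdiff_right_self, Finset.inf_eq_inter, Finset.inter_comm,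
                Finset.sdiff_union_inter]
            rw [Prod.mk.injEq]
            exact ⟨rfl, by rw [key y, key y', hxy, hyx]⟩
      _ = 2 ^ n * W.card ^ 2 := by
          rw [Finset.card_product, Finset.card_product, Finset.card_univ, Fintype.card_finset,
            Fintype.card_fin, sq]

end Combinatorial

section Transport

variable {K : Type*} [Field K]

/-- The set of `1`-bits of `i < 2ⁿ`, as a subset of `Fin n`. [folklore] -/
def bitsOf (n : ℕ) (i : Fin (2 ^ n)) : Finset (Fin n) :=
  (univ : Finset (Fin n)).filter fun l => i.val.testBit l

/-- A number `< 2ⁿ` is determined by its bits below `n`. [folklore] -/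
theorem bitsOf_injective (n : ℕ) : Function.Injective (bitsOf n) := by
  intro i j h
  apply Fin.ext
  apply Nat.eq_of_testBit_eq
  intro l
  by_cases hl : l < n
  · have := congrArg (fun s : Finset (Fin n) => (⟨l, hl⟩ : Fin n) ∈ s) h
    simp only [bitsOf, Finset.mem_filter, Finset.mem_univ, true_and, eq_iff_iff] at this
    rcases hi : i.val.testBit l <;> rcases hj : j.val.testBit l <;> simp_all
  · rw [not_lt] at hl
    rw [Nat.testBit_lt_two_pow (i.isLt.trans_le (Nat.pow_le_pow_right two_pos hl)),
      Nat.testBit_lt_two_pow (j.isLt.trans_le (Nat.pow_le_pow_right two_pos hl))]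

/-- `bitsOf n` is a bijection `Fin 2ⁿ → 𝒫(Fin n)` (injective between sets of equal size).
[folklore] -/
theorem bitsOf_bijective (n : ℕ) : Function.Bijective (bitsOf n) := by
  rw [Fintype.bijective_iff_injective_and_card]
  exact ⟨bitsOf_injective n, by simp [Fintype.card_finset]⟩

/-- `i ↦` its set of `1`-bits is a bijection `Fin 2ⁿ ≃ 𝒫(Fin n)`. [folklore] -/
def bitsEquiv (n : ℕ) : Fin (2 ^ n) ≃ Finset (Fin n) :=
  Equiv.ofBijective (bitsOf n) (bitsOf_bijective n)

/-- The tree's `bitInner n i j` (number of common `1`-bits) is `|bits(i) ∩ bits(j)|`.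
[cite: AlmanWilliams2017, §1, Def. 1.1] -/
theorem bitInner_eq_card_inter (n : ℕ) (i j : Fin (2 ^ n)) :
    bitInner n i j = (bitsEquiv n i ∩ bitsEquiv n j).card := by
  simp only [bitInner, bitsEquiv, Equiv.ofBijective_apply, bitsOf, ← Finset.filter_and]

/-- The tree's `walshHadamard K n` is the set-indexed `hadamardSet K n` re-indexed along
`bitsEquiv`. [cite: AlmanWilliams2017, §1, Def. 1.1] -/
theorem walshHadamard_eq_submatrix (K : Type*) [Field K] (n : ℕ) :
    walshHadamard K n = (hadamardSet K n).submatrix (bitsEquiv n) (bitsEquiv n) := by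
  ext i j
  simp only [walshHadamard, hadamardSet, Matrix.submatrix_apply, bitInner_eq_card_inter]

/-- A witness bounds the rigidity: if `rank (A + C) ≤ r` then `𝓡_A(r) ≤ |C|`. [cite: Lokam2009, Def. 2.1 (PDF p. 14)] -/
theorem rigidity_le_nnzEntries {N : ℕ} (A C : Matrix (Fin N) (Fin N) K) {r : ℕ}
    (h : (A + C).rank ≤ r) : rigidity A r ≤ nnzEntries C :=
  Nat.sInf_le ⟨C, h, rfl⟩

open Classical in
/-- Transport of a sparse correction of `hadamardSet` to a rigidity bound for `walshHadamard`.
[folklore] -/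
theorem rigidity_walshHadamard_le_of_correction {n r s : ℕ}
    (C : Matrix (Finset (Fin n)) (Finset (Fin n)) K) (hr : (hadamardSet K n + C).rank ≤ r)
    (hs : ((univ : Finset (Finset (Fin n) × Finset (Fin n))).filter
      (fun p => C p.1 p.2 ≠ 0)).card ≤ s) :
    rigidity (walshHadamard K n) r ≤ s := by
  let C' : Matrix (Fin (2 ^ n)) (Fin (2 ^ n)) K := C.submatrix (bitsEquiv n) (bitsEquiv n)
  have hrank : (walshHadamard K n + C').rank ≤ r := by
    change (walshHadamard K n + C.submatrix (bitsEquiv n) (bitsEquiv n)).rank ≤ r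
    rw [walshHadamard_eq_submatrix]
    change ((hadamardSet K n + C).submatrix (bitsEquiv n) (bitsEquiv n)).rank ≤ r
    rw [Matrix.rank_submatrix]
    exact hr
  refine (rigidity_le_nnzEntries _ C' hrank).trans (le_trans ?_ hs)
  unfold nnzEntries
  refine Finset.card_le_card_of_injOn (fun p => (bitsEquiv n p.1, bitsEquiv n p.2)) ?_ ?_
  · intro p hp
    simp only [Finset.coe_filter, Finset.mem_univ, true_and, Set.mem_setOf_eq] at hp ⊢
    exact hp
  · intro p _ q _ hpq
    simp only [Prod.mk.injEq, EmbeddingLike.apply_eq_iff_eq] at hpq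
    exact Prod.ext hpq.1 hpq.2

/-- **Rigidity of the Walsh–Hadamard transform, combinatorial bound (Alman 2021).** For all
thresholds `t, u`:
`𝓡_{H_n}(#{z : |z| < t} + 2 · #{x : |x| > u}) ≤ 2ⁿ · #{w : |w| ≤ u - t}²` over every field.
[cite: Alman2021Kronecker, §1.3 and §5, Lemma 5.1, Thm. 5.2] -/
theorem rigidity_walshHadamard_le_comb (K : Type*) [Field K] (n t u : ℕ) :
    rigidity (walshHadamard K n)
        (((univ : Finset (Finset (Fin n))).filter (fun z => z.card < t)).card +
          2 * ((univ : Finset (Finset (Fin n))).filter (fun x => u < x.card)).card) ≤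
      2 ^ n * ((univ : Finset (Finset (Fin n))).filter (fun w => w.card ≤ u - t)).card ^ 2 := by
  obtain ⟨C, hr, hs⟩ := exists_sparse_correction_hadamardSet (K := K) n t u
  exact rigidity_walshHadamard_le_of_correction C hr hs

end Transport

section Tails

open Real

/-! ### Binomial tail bounds, as counts of subsets of `Fin n` -/

/-- The Chernoff generating identity `∑_{z ⊆ [n]} e^{μ(n - 2|z|)} = (e^{-μ} + e^{μ})ⁿ`.
[folklore] -/
theorem sum_exp_mul_sub_two_card (n : ℕ) (μ : ℝ) :
    ∑ z : Finset (Fin n), exp (μ * (n - 2 * z.card)) = (exp (-μ) + exp μ) ^ n := by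
  have h := Fintype.sum_pow_mul_eq_add_pow (Fin n) (exp (-μ)) (exp μ)
  rw [Fintype.card_fin] at h
  rw [← h]
  refine Finset.sum_congr rfl fun z _ => ?_
  have hz : z.card ≤ n := by simpa using Finset.card_le_univ z
  rw [← Real.exp_nat_mul, ← Real.exp_nat_mul, ← Real.exp_add, Nat.cast_sub hz]
  congr 1
  ring

/-- Chernoff, lower tail: `#{z : |z| ≤ a} · e^{t(n - 2a)} ≤ (e^{-t} + e^{t})ⁿ` for `t ≥ 0`.
[folklore] -/
theorem card_filter_card_le_mul_exp_le (n : ℕ) {t : ℝ} (a : ℝ) (ht : 0 ≤ t) :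
    (((univ : Finset (Finset (Fin n))).filter (fun z => (z.card : ℝ) ≤ a)).card : ℝ) *
        exp (t * (n - 2 * a)) ≤ (exp (-t) + exp t) ^ n := by
  rw [← sum_exp_mul_sub_two_card n t]
  calc (((univ : Finset (Finset (Fin n))).filter (fun z => (z.card : ℝ) ≤ a)).card : ℝ) *
        exp (t * (n - 2 * a))
        = ∑ _z ∈ (univ : Finset (Finset (Fin n))).filter (fun z => (z.card : ℝ) ≤ a),
            exp (t * (n - 2 * a)) := by
          rw [Finset.sum_const, nsmul_eq_mul]
    _ ≤ ∑ z ∈ (univ : Finset (Finset (Fin n))).filter (fun z => (z.card : ℝ) ≤ a),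
            exp (t * (n - 2 * z.card)) := by
          refine Finset.sum_le_sum fun z hz => ?_
          simp only [Finset.mem_filter, Finset.mem_univ, true_and] at hz
          exact exp_le_exp.2 (mul_le_mul_of_nonneg_left (by linarith) ht)
    _ ≤ ∑ z : Finset (Fin n), exp (t * (n - 2 * z.card)) :=
          Finset.sum_le_univ_sum_of_nonneg fun z => (exp_pos _).le

/-- Chernoff, upper tail: `#{x : b ≤ |x|} · e^{t(2b - n)} ≤ (e^{-t} + e^{t})ⁿ` for `t ≥ 0`.
[folklore] -/
theorem card_filter_le_card_mul_exp_le (n : ℕ) {t : ℝ} (b : ℝ) (ht : 0 ≤ t) :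
    (((univ : Finset (Finset (Fin n))).filter (fun x => b ≤ (x.card : ℝ))).card : ℝ) *
        exp (t * (2 * b - n)) ≤ (exp (-t) + exp t) ^ n := by
  have h := sum_exp_mul_sub_two_card n (-t)
  rw [neg_neg, add_comm] at h
  rw [← h]
  calc (((univ : Finset (Finset (Fin n))).filter (fun x => b ≤ (x.card : ℝ))).card : ℝ) *
        exp (t * (2 * b - n))
        = ∑ _x ∈ (univ : Finset (Finset (Fin n))).filter (fun x => b ≤ (x.card : ℝ)),
            exp (t * (2 * b - n)) := by
          rw [Finset.sum_const, nsmul_eq_mul]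
    _ ≤ ∑ x ∈ (univ : Finset (Finset (Fin n))).filter (fun x => b ≤ (x.card : ℝ)),
            exp (-t * (n - 2 * x.card)) := by
          refine Finset.sum_le_sum fun x hx => ?_
          simp only [Finset.mem_filter, Finset.mem_univ, true_and] at hx
          exact exp_le_exp.2 (by nlinarith)
    _ ≤ ∑ x : Finset (Fin n), exp (-t * (n - 2 * x.card)) :=
          Finset.sum_le_univ_sum_of_nonneg fun x => (exp_pos _).le

/-- `e^{-t} + e^{t} = 2 cosh t ≤ 2 e^{t²/2}`. [folklore] -/
theorem exp_neg_add_exp_le (t : ℝ) : exp (-t) + exp t ≤ 2 * exp (t ^ 2 / 2) := by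
  have h := Real.cosh_le_exp_half_sq t
  rw [Real.cosh_eq] at h
  linarith

/-- Hoeffding for the lower binomial tail: `#{z ⊆ [n] : |z| ≤ (1/2 - δ)n} ≤ 2ⁿ e^{-2δ²n}`.
[cite: AlmanWilliams2017, §3, eq. (2)] -/
theorem card_filter_card_le_half_sub (n : ℕ) {δ : ℝ} (hδ : 0 ≤ δ) :
    (((univ : Finset (Finset (Fin n))).filter
        (fun z => (z.card : ℝ) ≤ (1 / 2 - δ) * n)).card : ℝ) ≤ 2 ^ n * exp (-(2 * δ ^ 2 * n)) := by
  have h := card_filter_card_le_mul_exp_le n ((1 / 2 - δ) * n) (t := 2 * δ) (by linarith)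
  have e1 : 2 * δ * (n - 2 * ((1 / 2 - δ) * n)) = 4 * δ ^ 2 * n := by ring
  rw [e1] at h
  have h2 : (exp (-(2 * δ)) + exp (2 * δ)) ^ n ≤ 2 ^ n * exp (-(2 * δ ^ 2 * n)) *
      exp (4 * δ ^ 2 * n) := by
    calc (exp (-(2 * δ)) + exp (2 * δ)) ^ n ≤ (2 * exp ((2 * δ) ^ 2 / 2)) ^ n :=
          pow_le_pow_left₀ (by positivity) (exp_neg_add_exp_le _) n
      _ = 2 ^ n * exp (-(2 * δ ^ 2 * n)) * exp (4 * δ ^ 2 * n) := by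
          rw [mul_pow, ← Real.exp_nat_mul, mul_assoc, ← Real.exp_add]
          congr 2
          ring
  exact le_of_mul_le_mul_right (h.trans h2) (exp_pos _)

/-- Hoeffding for the upper binomial tail: `#{x ⊆ [n] : (1/2 + δ)n ≤ |x|} ≤ 2ⁿ e^{-2δ²n}`.
[cite: AlmanWilliams2017, §3, eq. (2)] -/
theorem card_filter_half_add_le_card (n : ℕ) {δ : ℝ} (hδ : 0 ≤ δ) :
    (((univ : Finset (Finset (Fin n))).filter
        (fun x => (1 / 2 + δ) * n ≤ (x.card : ℝ))).card : ℝ) ≤ 2 ^ n * exp (-(2 * δ ^ 2 * n)) := by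
  have h := card_filter_le_card_mul_exp_le n ((1 / 2 + δ) * n) (t := 2 * δ) (by linarith)
  have e1 : 2 * δ * (2 * ((1 / 2 + δ) * n) - n) = 4 * δ ^ 2 * n := by ring
  rw [e1] at h
  have h2 : (exp (-(2 * δ)) + exp (2 * δ)) ^ n ≤ 2 ^ n * exp (-(2 * δ ^ 2 * n)) *
      exp (4 * δ ^ 2 * n) := by
    calc (exp (-(2 * δ)) + exp (2 * δ)) ^ n ≤ (2 * exp ((2 * δ) ^ 2 / 2)) ^ n :=
          pow_le_pow_left₀ (by positivity) (exp_neg_add_exp_le _) n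
      _ = 2 ^ n * exp (-(2 * δ ^ 2 * n)) * exp (4 * δ ^ 2 * n) := by
          rw [mul_pow, ← Real.exp_nat_mul, mul_assoc, ← Real.exp_add]
          congr 2
          ring
  exact le_of_mul_le_mul_right (h.trans h2) (exp_pos _)

/-- The small binomial tail: `#{w ⊆ [n] : |w| ≤ L} ≤ e^{L} (n/L)^{L} = (en/L)^L` for
`0 < L ≤ n`. [cite: AlmanWilliams2017, §3, eq. (1)] -/
theorem card_filter_card_le_le_exp_mul_rpow (n : ℕ) {L : ℝ} (hL : 0 < L) (hLn : L ≤ n) :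
    (((univ : Finset (Finset (Fin n))).filter (fun w => (w.card : ℝ) ≤ L)).card : ℝ) ≤
      exp L * ((n : ℝ) / L) ^ L := by
  have hn : (0 : ℝ) < n := hL.trans_le hLn
  set b : ℝ := L / n with hb
  have hb0 : 0 < b := div_pos hL hn
  have hb1 : b ≤ 1 := (div_le_one hn).2 hLn
  have key : (((univ : Finset (Finset (Fin n))).filter (fun w => (w.card : ℝ) ≤ L)).card : ℝ) *
      b ^ L ≤ exp L := by
    calc (((univ : Finset (Finset (Fin n))).filter (fun w => (w.card : ℝ) ≤ L)).card : ℝ) * b ^ L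
        = ∑ _w ∈ (univ : Finset (Finset (Fin n))).filter (fun w => (w.card : ℝ) ≤ L), b ^ L := by
          rw [Finset.sum_const, nsmul_eq_mul]
      _ ≤ ∑ w ∈ (univ : Finset (Finset (Fin n))).filter (fun w => (w.card : ℝ) ≤ L),
            b ^ (w.card : ℝ) := by
          refine Finset.sum_le_sum fun w hw => ?_
          simp only [Finset.mem_filter, Finset.mem_univ, true_and] at hw
          exact Real.rpow_le_rpow_of_exponent_ge hb0 hb1 hw
      _ ≤ ∑ w : Finset (Fin n), b ^ (w.card : ℝ) :=
          Finset.sum_le_univ_sum_of_nonneg fun w => by positivity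
      _ = ∑ w : Finset (Fin n), b ^ w.card * 1 ^ (Fintype.card (Fin n) - w.card) := by
          simp [Real.rpow_natCast]
      _ = (b + 1) ^ n := by rw [Fintype.sum_pow_mul_eq_add_pow, Fintype.card_fin]
      _ ≤ exp b ^ n := pow_le_pow_left₀ (by positivity) (by linarith [add_one_le_exp b]) n
      _ = exp L := by rw [← Real.exp_nat_mul]; congr 1; rw [hb]; field_simp
  have hbL : 0 < b ^ L := Real.rpow_pos_of_pos hb0 L
  rw [← le_div_iff₀ hbL] at key
  refine key.trans_eq ?_
  rw [div_eq_mul_inv, ← Real.inv_rpow hb0.le, hb, inv_div]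

end Tails

section Assembly

open Real

/-! ### The fact, its second name, and the proof -/

/-- **Deprecated second name (2026-08-16) of the catalogue fact `HadamardNotRigid`** — a by-name
synonym, no second copy of the statement: for every field `K` (universe `u`) there are `c > 0` and
`ε₀ ∈ (0, 1)` such that for every `ε ∈ (0, ε₀]` and all sufficiently large `n`,
`𝓡_{H_n}(⌊2^{(1 − c·ε²/log²(1/ε))n}⌋) ≤ 2^{(1+ε)n}` over `K`. History (module docstring): under
this name the corrected statement — exponent `log²(1/ε)`, as proved in §3 of the source and as
stated in [Alman2021Kronecker] §1.1 / Thm. 5.2 — was first vendored and proved (2026-08-15),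
while the entry still rendered the printed single logarithm; since the verdict clean-up of
2026-08-16 the entry `HadamardNotRigid` states it itself, and this name survives, deprecated (see
the end of the file), only because the ledger recorded the discharge `HadamardNotRigidLogSq_holds`.
Use `HadamardNotRigid` / `HadamardNotRigid_holds`; the barrier's catalogue block lives on the
entry. [cite: AlmanWilliams2017, §1, Thm. 1.1 (with the exponent as proved in §3)];
[cite: Alman2021Kronecker, §1.1 and §5, Thm. 5.2] -/
def HadamardNotRigidLogSq : Prop :=
  HadamardNotRigid.{u}
set_option maxHeartbeats 400000 in -- buildfix (bf3-g27): 160k/180k FAIL, 200k PASS at accept time; line-neutral budget line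
/-- **Quantitative non-rigidity of `H_n` (explicit constants, every field).** For
`0 < ε ≤ 1/30` and `n ≥ 800 log²(1/ε)/ε²` (`n ≥ 1`):
`𝓡_{H_n}(⌊2^{(1 − ε²/(400 log²(1/ε)))n}⌋) ≤ 2^{(1+ε)n}`. (Alman's disjointness decomposition
with `δ = ε/(20 log(1/ε))`: rank `≤ 3·2ⁿe^{−2δ²n} ≤ 2^{(1−δ²)n}`, changes
`≤ 2ⁿ(e/2δ)^{4δn} ≤ 2^{(1+ε)n}`.)
[cite: Alman2021Kronecker, §1.3 and §5, Thm. 5.2];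
[cite: AlmanWilliams2017, §1, Thm. 1.1] -/
theorem rigidity_walshHadamard_le_rpow (K : Type*) [Field K] {ε : ℝ} (hε : 0 < ε)
    (hε' : ε ≤ 1 / 30) {n : ℕ} (hn1 : 0 < n)
    (hn : 800 * Real.log (1 / ε) ^ 2 / ε ^ 2 ≤ n) :
    (rigidity (walshHadamard K n)
        ⌊(2 : ℝ) ^ ((1 - ε ^ 2 / (400 * Real.log (1 / ε) ^ 2)) * n)⌋₊ : ℝ) ≤
      (2 : ℝ) ^ ((1 + ε) * n) := by
  -- the constants `L = log(1/ε) ≥ 1 + log 10`, `δ = ε/(20 L)`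
  set L := Real.log (1 / ε) with hLdef
  have hL : 1 + Real.log 10 ≤ L := by
    have h30 : (30 : ℝ) ≤ 1 / ε := by
      rw [le_div_iff₀ hε]; nlinarith
    have h10e : 10 * exp 1 ≤ 1 / ε := le_trans (by nlinarith [Real.exp_one_lt_d9]) h30
    have := Real.log_le_log (by positivity) h10e
    rwa [Real.log_mul (by norm_num) (exp_pos 1).ne', Real.log_exp, add_comm] at this
  have hlog10 : 0 < Real.log 10 := Real.log_pos (by norm_num)
  have hL0 : 0 < L := by linarith
  set δ := ε / (20 * L) with hδdef
  have hδ0 : 0 < δ := by positivity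
  have hδ1 : δ ≤ 1 / 600 := by
    rw [hδdef, div_le_div_iff₀ (by positivity) (by norm_num)]
    nlinarith
  have hn0 : (0 : ℝ) < n := by exact_mod_cast hn1
  have hγ : ε ^ 2 / (400 * L ^ 2) = δ ^ 2 := by
    rw [hδdef]; field_simp; ring
  -- thresholds `t = ⌈(1/2 - δ)n⌉`, `u = ⌊(1/2 + δ)n⌋`
  set a : ℝ := (1 / 2 - δ) * n with ha
  set b : ℝ := (1 / 2 + δ) * n with hb
  have hb0 : 0 ≤ b := by positivity
  set t : ℕ := ⌈a⌉₊ with ht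
  set u : ℕ := ⌊b⌋₊ with hu
  have hcomb := rigidity_walshHadamard_le_comb K n t u
  set Lc := ((univ : Finset (Finset (Fin n))).filter (fun z => z.card < t)).card with hLc
  set Hc := ((univ : Finset (Finset (Fin n))).filter (fun x => u < x.card)).card with hHc
  set F := ((univ : Finset (Finset (Fin n))).filter (fun w => w.card ≤ u - t)).card with hF
  -- the three counts
  have hLc' : (Lc : ℝ) ≤ 2 ^ n * exp (-(2 * δ ^ 2 * n)) := by
    refine le_trans ?_ (card_filter_card_le_half_sub n hδ0.le)
    exact_mod_cast Finset.card_le_card fun z hz => by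
      simp only [Finset.mem_filter, Finset.mem_univ, true_and] at hz ⊢
      exact (Nat.lt_ceil.1 hz).le
  have hHc' : (Hc : ℝ) ≤ 2 ^ n * exp (-(2 * δ ^ 2 * n)) := by
    refine le_trans ?_ (card_filter_half_add_le_card n hδ0.le)
    exact_mod_cast Finset.card_le_card fun x hx => by
      simp only [Finset.mem_filter, Finset.mem_univ, true_and] at hx ⊢
      exact ((Nat.floor_lt hb0).1 hx).le
  have hF' : (F : ℝ) ≤ exp (2 * δ * n) * (1 / (2 * δ)) ^ (2 * δ * n) := by
    have hsub : F ≤ ((univ : Finset (Finset (Fin n))).filter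
        (fun w => (w.card : ℝ) ≤ 2 * δ * n)).card := by
      refine Finset.card_le_card fun w hw => ?_
      simp only [Finset.mem_filter, Finset.mem_univ, true_and] at hw ⊢
      have h1 : (w.card : ℝ) ≤ ((u - t : ℕ) : ℝ) := by exact_mod_cast hw
      refine h1.trans ?_
      rcases le_or_gt t u with htu | htu
      · rw [Nat.cast_sub htu]
        have hu' : (u : ℝ) ≤ b := Nat.floor_le hb0
        have ht' : a ≤ (t : ℝ) := Nat.le_ceil a
        have hba : b - a = 2 * δ * n := by rw [ha, hb]; ring
        linarith
      · rw [Nat.sub_eq_zero_of_le htu.le]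
        push_cast
        positivity
    have hT2 := card_filter_card_le_le_exp_mul_rpow n (L := 2 * δ * n) (by positivity)
      (by nlinarith)
    refine (le_trans (by exact_mod_cast hsub) hT2).trans_eq ?_
    congr 2
    field_simp
  -- rank side: `Lc + 2 Hc ≤ 3 · 2ⁿ e^{-2δ²n} ≤ 2^{(1-δ²)n}`
  have hR : Lc + 2 * Hc ≤ ⌊(2 : ℝ) ^ ((1 - ε ^ 2 / (400 * L ^ 2)) * n)⌋₊ := by
    rw [Nat.le_floor_iff (by positivity), hγ]
    push_cast
    have h2 : 2 ≤ δ ^ 2 * n := by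
      have hpos : 0 < ε ^ 2 / (400 * L ^ 2) := by positivity
      have := mul_le_mul_of_nonneg_left hn hpos.le
      rw [← hγ]
      refine le_trans (le_of_eq ?_) this
      field_simp
      ring
    have h3 : (3 : ℝ) ≤ exp (δ ^ 2 * n) := by linarith [add_one_le_exp (δ ^ 2 * n)]
    have hlog2 : Real.log 2 ≤ 1 := by linarith [Real.log_two_lt_d9]
    calc (Lc : ℝ) + 2 * Hc ≤ 3 * (2 ^ n * exp (-(2 * δ ^ 2 * n))) := by linarith
      _ ≤ exp (δ ^ 2 * n) * (2 ^ n * exp (-(2 * δ ^ 2 * n))) :=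
          mul_le_mul_of_nonneg_right h3 (by positivity)
      _ = 2 ^ n * (exp (δ ^ 2 * n) * exp (-(2 * δ ^ 2 * n))) := by ring
      _ = 2 ^ n * exp (-(δ ^ 2 * n)) := by rw [← Real.exp_add]; congr 1; ring
      _ ≤ 2 ^ n * (2 : ℝ) ^ (-(δ ^ 2 * n)) := by
          refine mul_le_mul_of_nonneg_left ?_ (by positivity)
          rw [Real.rpow_def_of_pos two_pos]
          exact exp_le_exp.2 (by nlinarith [sq_nonneg δ])
      _ = (2 : ℝ) ^ ((1 - δ ^ 2) * (n : ℝ)) := by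
          rw [show (1 - δ ^ 2) * (n : ℝ) = (n : ℝ) + -(δ ^ 2 * n) by ring,
            Real.rpow_add two_pos, Real.rpow_natCast]
  -- sparsity side: `2ⁿ F² ≤ 2ⁿ e^{4δn(1 + log(1/2δ))} ≤ 2^{(1+ε)n}`
  have hS : (2 : ℝ) ^ n * (F : ℝ) ^ 2 ≤ (2 : ℝ) ^ ((1 + ε) * n) := by
    have h2δ : 1 / (2 * δ) = 10 * L * (1 / ε) := by
      rw [hδdef]; field_simp; ring
    have hlog2δ : Real.log (1 / (2 * δ)) ≤ 3 * L - 2 := by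
      rw [h2δ, Real.log_mul (by positivity) (by positivity), Real.log_mul (by norm_num) hL0.ne']
      have := Real.log_le_sub_one_of_pos hL0
      linarith
    have hkey : 4 * δ * (1 + Real.log (1 / (2 * δ))) ≤ ε * Real.log 2 := by
      have hlog2 := Real.log_two_gt_d9
      calc 4 * δ * (1 + Real.log (1 / (2 * δ))) ≤ 4 * δ * (3 * L) :=
            mul_le_mul_of_nonneg_left (by linarith) (by positivity)
        _ = 3 / 5 * ε := by rw [hδdef]; field_simp; ring
        _ ≤ ε * Real.log 2 := by nlinarith
    have hF2 : (F : ℝ) ^ 2 ≤ exp (4 * δ * n * (1 + Real.log (1 / (2 * δ)))) := by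
      calc (F : ℝ) ^ 2 ≤ (exp (2 * δ * n) * (1 / (2 * δ)) ^ (2 * δ * n)) ^ 2 :=
            pow_le_pow_left₀ (by positivity) hF' 2
        _ = exp (4 * δ * n * (1 + Real.log (1 / (2 * δ)))) := by
            rw [Real.rpow_def_of_pos (by positivity : (0 : ℝ) < 1 / (2 * δ)), ← Real.exp_add,
              ← Real.exp_nat_mul]
            congr 1
            push_cast
            ring
    calc (2 : ℝ) ^ n * (F : ℝ) ^ 2 ≤ 2 ^ n * exp (4 * δ * n * (1 + Real.log (1 / (2 * δ)))) :=
          mul_le_mul_of_nonneg_left hF2 (by positivity)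
      _ ≤ 2 ^ n * exp (ε * Real.log 2 * n) := by
          refine mul_le_mul_of_nonneg_left (exp_le_exp.2 ?_) (by positivity)
          nlinarith
      _ = (2 : ℝ) ^ ((1 + ε) * (n : ℝ)) := by
          rw [show (1 + ε) * (n : ℝ) = (n : ℝ) + ε * n by ring, Real.rpow_add two_pos,
            Real.rpow_natCast, Real.rpow_def_of_pos two_pos]
          congr 2
          ring
  -- assemble
  calc (rigidity (walshHadamard K n) ⌊(2 : ℝ) ^ ((1 - ε ^ 2 / (400 * L ^ 2)) * n)⌋₊ : ℝ)
      ≤ rigidity (walshHadamard K n) (Lc + 2 * Hc) := by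
        exact_mod_cast rigidity_anti (walshHadamard K n) hR
    _ ≤ ((2 ^ n * F ^ 2 : ℕ) : ℝ) := by exact_mod_cast hcomb
    _ = (2 : ℝ) ^ n * (F : ℝ) ^ 2 := by push_cast; ring
    _ ≤ (2 : ℝ) ^ ((1 + ε) * n) := hS

/-- **Discharge of the catalogue fact**: `HadamardNotRigid` holds — for every field, with
`c = 1/400` and `ε₀ = 1/30` (from `rigidity_walshHadamard_le_rpow`, once
`n ≥ 800 log²(1/ε)/ε²`). [cite: AlmanWilliams2017, §1, Thm. 1.1 (with the exponent as proved in §3)];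
[cite: Alman2021Kronecker, §5, Thm. 5.2] -/
theorem HadamardNotRigid_holds : HadamardNotRigid := by
  intro K _
  refine ⟨1 / 400, by norm_num, 1 / 30, by norm_num, by norm_num, fun ε hε hε' => ?_⟩
  have heq : ∀ n : ℕ, (1 - 1 / 400 * ε ^ 2 / Real.log (1 / ε) ^ 2) * (n : ℝ) =
      (1 - ε ^ 2 / (400 * Real.log (1 / ε) ^ 2)) * n := fun n => by ring
  filter_upwards [eventually_gt_atTop 0,
    (tendsto_natCast_atTop_atTop (R := ℝ)).eventually_ge_atTop
      (800 * Real.log (1 / ε) ^ 2 / ε ^ 2)] with n hn0 hn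
  rw [heq]
  exact rigidity_walshHadamard_le_rpow K hε hε' hn0 hn

/-- Deprecated (2026-08-16) discharge of the deprecated second name `HadamardNotRigidLogSq`; it IS
`HadamardNotRigid_holds` (the two names are definitionally one proposition). Kept because the
ledger recorded the prove-seat's item as closed by this name. [cite: AlmanWilliams2017, §1, Thm. 1.1];
[cite: Alman2021Kronecker, §5, Thm. 5.2] -/
theorem HadamardNotRigidLogSq_holds : HadamardNotRigidLogSq.{u} :=
  HadamardNotRigid_holds

/-! ### The route-facing readings, now unconditional -/

/-- Deprecated (2026-08-16) synonym of the entry's reading `HadamardNotRigid.no_valiant_rigidity`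
taking the deprecated second name as hypothesis: for every field `K` and every `δ > 0`,
eventually `𝓡_{H_n}(⌊2ⁿ/n⌋) < 2^{(1+δ)n}`. [cite: AlmanWilliams2017, §1 (discussion after Thm. 1.1)] -/
theorem HadamardNotRigidLogSq.no_valiant_rigidity (h : HadamardNotRigidLogSq.{u}) (K : Type u)
    [Field K] {δ : ℝ} (hδ : 0 < δ) :
    ∀ᶠ n : ℕ in atTop,
      (rigidity (walshHadamard K n) (2 ^ n / n) : ℝ) < (2 : ℝ) ^ ((1 + δ) * n) :=
  HadamardNotRigid.no_valiant_rigidity h K hδ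

/-- **No Valiant-strength rigidity for the Walsh–Hadamard transform (unconditional).** For
every field `K` and every `δ > 0`, for all large `n`, `𝓡_{H_n}(⌊2ⁿ/n⌋) < 2^{(1+δ)n}`; so no
bound `𝓡_{H_n}(2ⁿ/n) ≥ 2^{(1+δ)n}` — let alone at the larger rank `2ⁿ/log n` of Valiant's
regime — holds infinitely often. [cite: AlmanWilliams2017, §1, Thm. 1.1 and the discussion after it ("We would have required lower bounds of the form 𝓡_{H_n}(2ⁿ/(log n)) ≥ 2^{n(1+ε)} for some ε > 0 … Theorem 1.1 shows this is impossible")]; [cite: Alman2021Kronecker, §5, Thm. 5.2] -/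
theorem walshHadamard_no_valiant_rigidity (K : Type u) [Field K] {δ : ℝ} (hδ : 0 < δ) :
    ∀ᶠ n : ℕ in atTop,
      (rigidity (walshHadamard K n) (2 ^ n / n) : ℝ) < (2 : ℝ) ^ ((1 + δ) * n) :=
  HadamardNotRigid_holds.no_valiant_rigidity K hδ

/-- The paper's form, unconditional: for every `δ > 0`, eventually
`𝓡_{H_n}(⌊2ⁿ/log₂ n⌋) < 2^{(1+δ)n}`. [cite: AlmanWilliams2017, §1 (discussion after Thm. 1.1)] -/
theorem walshHadamard_no_valiant_rigidity_log (K : Type u) [Field K] {δ : ℝ} (hδ : 0 < δ) :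
    ∀ᶠ n : ℕ in atTop,
      (rigidity (walshHadamard K n) (2 ^ n / Nat.log 2 n) : ℝ) < (2 : ℝ) ^ ((1 + δ) * n) := by
  filter_upwards [walshHadamard_no_valiant_rigidity K hδ, eventually_ge_atTop 2] with n hn hn2
  have hlog : 0 < Nat.log 2 n := Nat.log_pos one_lt_two hn2
  have hrank : 2 ^ n / n ≤ 2 ^ n / Nat.log 2 n :=
    Nat.div_le_div_left (Nat.log_le_self 2 n) hlog
  calc (rigidity (walshHadamard K n) (2 ^ n / Nat.log 2 n) : ℝ)
      ≤ rigidity (walshHadamard K n) (2 ^ n / n) := by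
        exact_mod_cast rigidity_anti (walshHadamard K n) hrank
    _ < (2 : ℝ) ^ ((1 + δ) * n) := hn

/-- Deprecated (2026-08-16): `HadamardNotRigid → HadamardNotRigidLogSq` is an identity since the
entry was restated in place (the second name is a by-name synonym of the first). History: while
`HadamardNotRigid` rendered the printed single-logarithm sentence of Thm. 1.1 this recorded that
the printed-strength statement implies the corrected one (for `ε ≤ e⁻¹`, `log(1/ε) ≥ 1`, so the
single-logarithm target rank is the smaller one and `rigidity_anti` applies).
[cite: AlmanWilliams2017, §1, Thm. 1.1] -/
theorem HadamardNotRigid.logSq (h : HadamardNotRigid.{u}) : HadamardNotRigidLogSq.{u} :=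
  h

/-! ### Deprecations (named-fact verdict clean-up, 2026-08-16)

Attached last, by `attribute [deprecated …]`, so that the declarations above can state and prove
the second name without tripping the deprecation linter inside this file; every use elsewhere
warns and names the replacement on the catalogue entry. -/

attribute [deprecated HadamardNotRigid "`HadamardNotRigidLogSq` is the deprecated second name of the catalogue fact `Literature.Barriers.PneNP.HadamardNotRigid` (HadamardNotRigid.lean), which states the same proposition — exponent `c·ε²/log²(1/ε)` — since the named-fact verdict clean-up of 2026-08-16" (since := "2026-08-16")]
  HadamardNotRigidLogSq

attribute [deprecated HadamardNotRigid_holds (since := "2026-08-16")] HadamardNotRigidLogSq_holds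

attribute [deprecated HadamardNotRigid.no_valiant_rigidity (since := "2026-08-16")]
  HadamardNotRigidLogSq.no_valiant_rigidity

attribute [deprecated HadamardNotRigid_holds "`HadamardNotRigid → HadamardNotRigidLogSq` is an identity since the entry was restated in place (2026-08-16); use `HadamardNotRigid_holds`" (since := "2026-08-16")]
  HadamardNotRigid.logSq

end Assembly


end Literature.Barriers.PneNP

end
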